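import Mathlib
import Literature.Probability.LatticeModels.ProdBernoulliIndependence
import Literature.Probability.Percolation.ConditionalPositiveAssociation
import Literature.Probability.Percolation.TwoClusterConditionalAssociation
import Literature.Probability.Percolation.PercolationProofs
import Literature.Probability.Percolation.ClusterBoundary
import HarnessLib

/-!
# Crux `PercNearOneGluing.NearOneGluing` (stmt-CriticalPhenomena-4574), line `bhk-dyadic-thinning` — stub `stub_bhkClusterAssociation`

Helper file for the crux skeleton `Cruxes/NearOneGluing/Lines/bhk-dyadic-thinning.lean` (lead
prover-line-stmt-CriticalPhenomena-4574-0).  Proves exactly the registered stub signature; lands with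
`--supports stmt-CriticalPhenomena-4574`.

The content is van den Berg–Häggström–Kahn 2006 (RSA 29, arXiv:math/0408176), the "standard (and
easy) reduction" of Thm. 1.3 (functional form: `E[fg | s ↮ X] ≥ E[f | s ↮ X] E[g | s ↮ X]` for
`f, g` increasing functions of the open edge cluster `C_s`) to Thm. 1.2 (= Thm. 1.1 with `Y = X`,
the same inequality for increasing EVENTS determined by `C_s`), on the finite configuration space
`Set (Sym2 (Fin n))` and in denominator-free form.  The events inequality is the HYPOTHESIS of the
stub.  The proof is finite-dimensional bilinear algebra:

* a linear functional on `Ω → ℝ` (`Ω` finite) killing constants and nonnegative on indicators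
  of `r`-up-closed sets is nonnegative on every `r`-monotone `f`
  (`nonneg_of_forall_indicator_nonneg`: truncate the top value,
  `f = min f v₂ + (v₁ - v₂) • 𝟙{v₁ ≤ f}`, and induct on the number of values);
* with weights `p`, the covariance form `Φ_p(f, g) = (∑ p)(∑ p f g) - (∑ p f)(∑ p g)` is
  bilinear, symmetric and kills constants, so `Φ_p ≥ 0` on pairs of `r`-monotone functions as
  soon as it is so on pairs of indicators of `r`-up-closed sets (`sum_mul_sum_le_of_upClosed`);
* with `p ω = (μ.restrict D).real {ω}` integrals and probabilities are the finite sums above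
  (`integral_eq_sum_measureReal_mul`), and `r ω ω' := C_s ω ⊆ C_s ω'`.
-/

namespace Summit.CriticalPhenomena.PercolationContinuityZ3.Theorems

open scoped BigOperators Classical
open MeasureTheory Set
open Literature.Probability.LatticeModels (prodBernoulli)
open Literature.Probability.Percolation (openConn measurableSet_openConn_holds)

/-! ### Bilinear extension from up-closed events to monotone functions (finite sums) -/

section Extension

variable {Ω : Type*} [Fintype Ω]

/-- A linear functional on `Ω → ℝ` (`Ω` finite) that kills constants and is nonnegative on the
indicators of `r`-up-closed sets is nonnegative on every `r`-monotone function: truncate the top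
value, `f = min f v₂ + (v₁ - v₂) • 𝟙{v₁ ≤ f}`, and induct on the number of values of `f`. -/
theorem nonneg_of_forall_indicator_nonneg (r : Ω → Ω → Prop) (L : (Ω → ℝ) → ℝ)
    (hlin : ∀ (f g : Ω → ℝ) (c : ℝ), L (f + c • g) = L f + c * L g)
    (hconst : ∀ c : ℝ, L (fun _ => c) = 0)
    (hind : ∀ A : Set Ω, (∀ ω ω', ω ∈ A → r ω ω' → ω' ∈ A) → 0 ≤ L (A.indicator 1))
    (f : Ω → ℝ) (hf : ∀ ω ω', r ω ω' → f ω ≤ f ω') : 0 ≤ L f := by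
  suffices key : ∀ (k : ℕ) (f : Ω → ℝ), (Finset.univ.image f).card ≤ k + 1 →
      (∀ ω ω', r ω ω' → f ω ≤ f ω') → 0 ≤ L f from
    key _ f (Nat.le_succ _) hf
  intro k
  induction k with
  | zero =>
    intro f hcard hf
    obtain hΩ | ⟨⟨ω₀⟩⟩ := isEmpty_or_nonempty Ω
    · have h0 : f = fun _ => 0 := funext fun ω => hΩ.elim ω
      rw [h0]
      exact (hconst 0).ge
    · have hcard1 : (Finset.univ.image f).card ≤ 1 := by omega
      have h0 : f = fun _ => f ω₀ := funext fun ω =>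
        Finset.card_le_one.1 hcard1 (f ω) (Finset.mem_image_of_mem f (Finset.mem_univ ω))
          (f ω₀) (Finset.mem_image_of_mem f (Finset.mem_univ ω₀))
      rw [h0]
      exact (hconst _).ge
  | succ k ih =>
    intro f hcard hf
    by_cases hsmall : (Finset.univ.image f).card ≤ k + 1
    · exact ih f hsmall hf
    rw [not_le] at hsmall
    set R : Finset ℝ := Finset.univ.image f with hR
    have hmemR : ∀ ω, f ω ∈ R := fun ω => Finset.mem_image_of_mem f (Finset.mem_univ ω)
    have hRne : R.Nonempty := Finset.card_pos.1 (by omega)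
    have hv₁R : R.max' hRne ∈ R := R.max'_mem hRne
    have hR'card : (R.erase (R.max' hRne)).card = R.card - 1 := Finset.card_erase_of_mem hv₁R
    have hR'ne : (R.erase (R.max' hRne)).Nonempty := Finset.card_pos.1 (by omega)
    -- the top value `v₁` and the second largest value `v₂`
    obtain ⟨v₁, hv₁⟩ : ∃ v, v = R.max' hRne := ⟨_, rfl⟩
    obtain ⟨v₂, hv₂⟩ : ∃ v, v = (R.erase (R.max' hRne)).max' hR'ne := ⟨_, rfl⟩
    have hle₁ : ∀ ω, f ω ≤ v₁ := fun ω => hv₁ ▸ R.le_max' (f ω) (hmemR ω)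
    have hle₂ : ∀ ω, f ω ≠ v₁ → f ω ≤ v₂ := fun ω hne =>
      hv₂ ▸ Finset.le_max' _ (f ω) (Finset.mem_erase.2 ⟨hv₁ ▸ hne, hmemR ω⟩)
    have hv₂R' : v₂ ∈ R.erase (R.max' hRne) := hv₂ ▸ Finset.max'_mem _ hR'ne
    have hv₂₁ : v₂ ≤ v₁ := hv₁ ▸ R.le_max' v₂ (Finset.mem_of_mem_erase hv₂R')
    -- truncation `f'` at the second value and the top superlevel set `S`
    have hdecomp : f = (fun ω => min (f ω) v₂) + (v₁ - v₂) • {ω | v₁ ≤ f ω}.indicator 1 := by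
      funext ω
      simp only [Pi.add_apply, Pi.smul_apply, smul_eq_mul, Set.indicator_apply,
        Set.mem_setOf_eq, Pi.one_apply]
      by_cases hω : v₁ ≤ f ω
      · rw [if_pos hω, le_antisymm (hle₁ ω) hω, min_eq_right hv₂₁]
        ring
      · rw [if_neg hω, min_eq_left (hle₂ ω fun h => hω h.ge)]
        ring
    have hf'mono : ∀ ω ω', r ω ω' → min (f ω) v₂ ≤ min (f ω') v₂ := fun ω ω' h =>
      min_le_min (hf ω ω' h) le_rfl
    have hcard' : (Finset.univ.image fun ω => min (f ω) v₂).card ≤ k + 1 := by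
      have hsub : (Finset.univ.image fun ω => min (f ω) v₂) ⊆ R.erase (R.max' hRne) := by
        intro v hv
        obtain ⟨ω, -, rfl⟩ := Finset.mem_image.1 hv
        by_cases hω : f ω = v₁
        · rw [hω, min_eq_right hv₂₁]
          exact hv₂R'
        · rw [min_eq_left (hle₂ ω hω)]
          exact Finset.mem_erase.2 ⟨hv₁ ▸ hω, hmemR ω⟩
      have := Finset.card_le_card hsub
      omega
    have hSup : ∀ ω ω', ω ∈ {ω | v₁ ≤ f ω} → r ω ω' → ω' ∈ {ω | v₁ ≤ f ω} :=
      fun ω ω' hω h => le_trans (α := ℝ) hω (hf ω ω' h)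
    rw [hdecomp, hlin]
    exact add_nonneg (ih _ hcard' hf'mono) (mul_nonneg (sub_nonneg.2 hv₂₁) (hind _ hSup))

/-- **Events ⇒ functions for the covariance form.** With weights `p` on a finite type and
`Φ_p(f, g) = (∑ p)(∑ p·f·g) - (∑ p·f)(∑ p·g)`: if `Φ_p(𝟙_A, 𝟙_B) ≥ 0` for all `r`-up-closed
sets `A, B`, then `Φ_p(f, g) ≥ 0` for all `r`-monotone `f, g` (`Φ_p` is bilinear, symmetric and
kills constants; apply `nonneg_of_forall_indicator_nonneg` in each variable). -/
theorem sum_mul_sum_le_of_upClosed (r : Ω → Ω → Prop) (p : Ω → ℝ)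
    (h : ∀ A B : Set Ω, (∀ ω ω', ω ∈ A → r ω ω' → ω' ∈ A) →
      (∀ ω ω', ω ∈ B → r ω ω' → ω' ∈ B) →
      (∑ ω, p ω * A.indicator 1 ω) * (∑ ω, p ω * B.indicator 1 ω) ≤
        (∑ ω, p ω) * ∑ ω, p ω * (A.indicator 1 ω * B.indicator 1 ω))
    (f g : Ω → ℝ) (hf : ∀ ω ω', r ω ω' → f ω ≤ f ω') (hg : ∀ ω ω', r ω ω' → g ω ≤ g ω') :
    (∑ ω, p ω * f ω) * (∑ ω, p ω * g ω) ≤ (∑ ω, p ω) * ∑ ω, p ω * (f ω * g ω) := by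
  -- the covariance form `Φ`
  set Φ : (Ω → ℝ) → (Ω → ℝ) → ℝ := fun f g =>
    (∑ ω, p ω) * (∑ ω, p ω * (f ω * g ω)) - (∑ ω, p ω * f ω) * (∑ ω, p ω * g ω) with hΦ
  have hcomm : ∀ f g : Ω → ℝ, Φ f g = Φ g f := by
    intro f g
    simp only [hΦ]
    have h1 : ∑ ω, p ω * (f ω * g ω) = ∑ ω, p ω * (g ω * f ω) :=
      Finset.sum_congr rfl fun ω _ => by ring
    rw [h1]
    ring
  have hlin : ∀ (f h g : Ω → ℝ) (c : ℝ), Φ (f + c • h) g = Φ f g + c * Φ h g := by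
    intro f h g c
    simp only [hΦ]
    have h1 : ∑ ω, p ω * ((f + c • h) ω * g ω) =
        ∑ ω, p ω * (f ω * g ω) + c * ∑ ω, p ω * (h ω * g ω) := by
      rw [Finset.mul_sum, ← Finset.sum_add_distrib]
      exact Finset.sum_congr rfl fun ω _ => by
        simp only [Pi.add_apply, Pi.smul_apply, smul_eq_mul]; ring
    have h2 : ∑ ω, p ω * (f + c • h) ω = ∑ ω, p ω * f ω + c * ∑ ω, p ω * h ω := by
      rw [Finset.mul_sum, ← Finset.sum_add_distrib]
      exact Finset.sum_congr rfl fun ω _ => by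
        simp only [Pi.add_apply, Pi.smul_apply, smul_eq_mul]; ring
    rw [h1, h2]
    ring
  have hconst : ∀ (g : Ω → ℝ) (c : ℝ), Φ (fun _ => c) g = 0 := by
    intro g c
    simp only [hΦ]
    have h1 : ∑ ω, p ω * (c * g ω) = c * ∑ ω, p ω * g ω := by
      rw [Finset.mul_sum]
      exact Finset.sum_congr rfl fun ω _ => by ring
    have h2 : ∑ ω, p ω * c = c * ∑ ω, p ω := by
      rw [Finset.mul_sum]
      exact Finset.sum_congr rfl fun ω _ => by ring
    rw [h1, h2]
    ring
  have hind : ∀ A B : Set Ω, (∀ ω ω', ω ∈ A → r ω ω' → ω' ∈ A) →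
      (∀ ω ω', ω ∈ B → r ω ω' → ω' ∈ B) → 0 ≤ Φ (A.indicator 1) (B.indicator 1) := by
    intro A B hA hB
    simp only [hΦ]
    linarith [h A B hA hB]
  -- first variable, against indicators of up-closed sets; then the second variable
  have step : ∀ B : Set Ω, (∀ ω ω', ω ∈ B → r ω ω' → ω' ∈ B) →
      0 ≤ Φ f (B.indicator 1) := fun B hB =>
    nonneg_of_forall_indicator_nonneg r (fun φ => Φ φ (B.indicator 1))
      (fun φ ψ c => hlin φ ψ _ c) (fun c => hconst _ c) (fun A hA => hind A B hA hB) f hf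
  have key : 0 ≤ Φ f g :=
    nonneg_of_forall_indicator_nonneg r (fun ψ => Φ f ψ)
      (fun φ ψ c => by
        show Φ f (φ + c • ψ) = Φ f φ + c * Φ f ψ
        rw [hcomm, hlin, hcomm φ f, hcomm ψ f])
      (fun c => by
        show Φ f (fun _ => c) = 0
        rw [hcomm]
        exact hconst f c)
      step g hg
  simp only [hΦ] at key
  linarith

end Extension

/-! ### From finite measures to finite sums -/

section FiniteMeasure

variable {Ω : Type*} [Fintype Ω] [MeasurableSpace Ω] [MeasurableSingletonClass Ω]

/-- On a finite measurable space with measurable singletons, a Bochner integral against a finite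
measure is the finite weighted sum over the atoms. -/
theorem integral_eq_sum_measureReal_mul (ν : Measure Ω) [IsFiniteMeasure ν] (f : Ω → ℝ) :
    ∫ ω, f ω ∂ν = ∑ ω, ν.real {ω} * f ω := by
  rw [integral_fintype Integrable.of_finite]
  simp only [smul_eq_mul]

/-- On a finite measurable space with measurable singletons, the (real) measure of an event is
the weighted sum of its indicator over the atoms. -/
theorem measureReal_eq_sum_measureReal_mul_indicator (ν : Measure Ω) [IsFiniteMeasure ν]
    (E : Set Ω) : ν.real E = ∑ ω, ν.real {ω} * E.indicator 1 ω := by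
  rw [← integral_indicator_one E.toFinite.measurableSet, integral_eq_sum_measureReal_mul]

/-- **Conditional positive association, events ⇒ functions, for a finite measure on a finite
space.** If `ν A · ν B ≤ ν (A ∩ B) · ν univ` for all `r`-up-closed events `A, B`, then
`(∫ f dν)(∫ g dν) ≤ ν univ · ∫ f g dν` for all `r`-monotone real `f, g`. -/
theorem integral_mul_integral_le_of_upClosed (ν : Measure Ω) [IsFiniteMeasure ν]
    (r : Ω → Ω → Prop)
    (h : ∀ A B : Set Ω, (∀ ω ω', ω ∈ A → r ω ω' → ω' ∈ A) →
      (∀ ω ω', ω ∈ B → r ω ω' → ω' ∈ B) → ν.real A * ν.real B ≤ ν.real (A ∩ B) * ν.real univ)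
    (f g : Ω → ℝ) (hf : ∀ ω ω', r ω ω' → f ω ≤ f ω') (hg : ∀ ω ω', r ω ω' → g ω ≤ g ω') :
    (∫ ω, f ω ∂ν) * (∫ ω, g ω ∂ν) ≤ ν.real univ * ∫ ω, f ω * g ω ∂ν := by
  have hev : ∀ A B : Set Ω, (∀ ω ω', ω ∈ A → r ω ω' → ω' ∈ A) →
      (∀ ω ω', ω ∈ B → r ω ω' → ω' ∈ B) →
      (∑ ω, ν.real {ω} * A.indicator 1 ω) * (∑ ω, ν.real {ω} * B.indicator 1 ω) ≤
        (∑ ω, ν.real {ω}) * ∑ ω, ν.real {ω} * (A.indicator 1 ω * B.indicator 1 ω) := by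
    intro A B hA hB
    have hAB := h A B hA hB
    rw [measureReal_eq_sum_measureReal_mul_indicator ν A,
      measureReal_eq_sum_measureReal_mul_indicator ν B,
      measureReal_eq_sum_measureReal_mul_indicator ν (A ∩ B),
      measureReal_eq_sum_measureReal_mul_indicator ν univ, Set.inter_indicator_one] at hAB
    simp only [Set.indicator_univ, Pi.one_apply, mul_one, Pi.mul_apply] at hAB
    linarith
  have key := sum_mul_sum_le_of_upClosed r (fun ω => ν.real {ω}) hev f g hf hg
  rw [integral_eq_sum_measureReal_mul, integral_eq_sum_measureReal_mul,
    integral_eq_sum_measureReal_mul, measureReal_eq_sum_measureReal_mul_indicator ν univ]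
  simp only [Set.indicator_univ, Pi.one_apply, mul_one]
  exact key

end FiniteMeasure

/-- Registered stub `stub_bhkClusterAssociation` of crux stmt-CriticalPhenomena-4574 (line bhk-dyadic-thinning); see the line skeleton for the informal statement and sources. -/
theorem stub_bhkClusterAssociation :
    (∀ (n : ℕ) (w : Sym2 (Fin n) → unitInterval) (s : Fin n) (X Y : Set (Fin n))
      (A B : Set (Literature.Probability.Percolation.BondConfig (Fin n))),
      (∀ ω ω', ω ∈ A → Literature.Probability.Percolation.openEdgeCluster ω s ⊆
          Literature.Probability.Percolation.openEdgeCluster ω' s → ω' ∈ A) →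
      (∀ ω ω', ω ∈ B → Literature.Probability.Percolation.openEdgeCluster ω s ⊆
          Literature.Probability.Percolation.openEdgeCluster ω' s → ω' ∈ B) →
      s ∉ X → s ∉ Y →
      (Literature.Probability.LatticeModels.prodBernoulli w).real
          (A ∩ {ω | ∀ x ∈ X, ¬ (Literature.Probability.Percolation.openGraph ω).Reachable s x}) *
        (Literature.Probability.LatticeModels.prodBernoulli w).real
          (B ∩ {ω | ∀ y ∈ Y, ¬ (Literature.Probability.Percolation.openGraph ω).Reachable s y}) ≤
      (Literature.Probability.LatticeModels.prodBernoulli w).real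
          (A ∩ B ∩ {ω | ∀ z ∈ X ∩ Y, ¬ (Literature.Probability.Percolation.openGraph ω).Reachable s z}) *
        (Literature.Probability.LatticeModels.prodBernoulli w).real
          {ω | ∀ z ∈ X ∪ Y, ¬ (Literature.Probability.Percolation.openGraph ω).Reachable s z}) →
    ∀ (n : ℕ) (w : Sym2 (Fin n) → unitInterval) (s : Fin n) (X : Set (Fin n))
      (F G : Set (Sym2 (Fin n)) → ℝ), Monotone F → Monotone G → s ∉ X →
      (∫ ω in {ω : Literature.Probability.Percolation.BondConfig (Fin n) |
            ∀ x ∈ X, ¬ (Literature.Probability.Percolation.openGraph ω).Reachable s x},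
          F (Literature.Probability.Percolation.openEdgeCluster ω s)
            ∂(Literature.Probability.LatticeModels.prodBernoulli w)) *
        (∫ ω in {ω : Literature.Probability.Percolation.BondConfig (Fin n) |
            ∀ x ∈ X, ¬ (Literature.Probability.Percolation.openGraph ω).Reachable s x},
          G (Literature.Probability.Percolation.openEdgeCluster ω s)
            ∂(Literature.Probability.LatticeModels.prodBernoulli w)) ≤
      (Literature.Probability.LatticeModels.prodBernoulli w).real
          {ω : Literature.Probability.Percolation.BondConfig (Fin n) |
            ∀ x ∈ X, ¬ (Literature.Probability.Percolation.openGraph ω).Reachable s x} *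
        ∫ ω in {ω : Literature.Probability.Percolation.BondConfig (Fin n) |
            ∀ x ∈ X, ¬ (Literature.Probability.Percolation.openGraph ω).Reachable s x},
          F (Literature.Probability.Percolation.openEdgeCluster ω s) *
            G (Literature.Probability.Percolation.openEdgeCluster ω s)
            ∂(Literature.Probability.LatticeModels.prodBernoulli w) := by
  intro hBHK n w s X F G hF hG hs
  have hev : ∀ A B : Set (Literature.Probability.Percolation.BondConfig (Fin n)),
      (∀ ω ω', ω ∈ A → Literature.Probability.Percolation.openEdgeCluster ω s ⊆
          Literature.Probability.Percolation.openEdgeCluster ω' s → ω' ∈ A) →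
      (∀ ω ω', ω ∈ B → Literature.Probability.Percolation.openEdgeCluster ω s ⊆
          Literature.Probability.Percolation.openEdgeCluster ω' s → ω' ∈ B) →
      ((prodBernoulli w).restrict {ω : Literature.Probability.Percolation.BondConfig (Fin n) |
            ∀ x ∈ X, ¬ (Literature.Probability.Percolation.openGraph ω).Reachable s x}).real A *
        ((prodBernoulli w).restrict {ω : Literature.Probability.Percolation.BondConfig (Fin n) |
            ∀ x ∈ X, ¬ (Literature.Probability.Percolation.openGraph ω).Reachable s x}).real B ≤
      ((prodBernoulli w).restrict {ω : Literature.Probability.Percolation.BondConfig (Fin n) |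
            ∀ x ∈ X, ¬ (Literature.Probability.Percolation.openGraph ω).Reachable s x}).real
          (A ∩ B) *
        ((prodBernoulli w).restrict {ω : Literature.Probability.Percolation.BondConfig (Fin n) |
            ∀ x ∈ X, ¬ (Literature.Probability.Percolation.openGraph ω).Reachable s x}).real
          univ := by
    intro A B hA hB
    have h := hBHK n w s X X A B hA hB hs hs
    rw [Set.inter_self, Set.union_self] at h
    rw [measureReal_restrict_apply A.toFinite.measurableSet,
      measureReal_restrict_apply B.toFinite.measurableSet,
      measureReal_restrict_apply (A ∩ B).toFinite.measurableSet, measureReal_restrict_apply_univ]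
    exact h
  have key := integral_mul_integral_le_of_upClosed _ _ hev
    (fun ω => F (Literature.Probability.Percolation.openEdgeCluster ω s))
    (fun ω => G (Literature.Probability.Percolation.openEdgeCluster ω s))
    (fun _ _ hle => hF hle) (fun _ _ hle => hG hle)
  rwa [measureReal_restrict_apply_univ] at key

end Summit.CriticalPhenomena.PercolationContinuityZ3.Theorems
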